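import Summits.ABC.StewartYu.MatveevStepData
import Mathlib.LinearAlgebra.Dimension.Finrank
import HarnessLib

/-!
# Cell abc-stewartyu, Gen-3 frames: the rank of the obstruction lattice is at most the number of logarithms

`Summits/ABC/StewartYu/ObstructionRankLe.lean` — cell `abc-stewartyu` (route `PadicPrimesKummerThird`, cruxes
`Y07Odd` stmt-ABC-19658 / `Y07Two` stmt-ABC-19659), seat p3 (g4).  Theorems only.

`Nesterenko2003_prop51` returns `r` ℤ-independent rows `M : Fin r → ℤⁿ` and the dimension inequality
`H.addDim + (n − r) ≤ n` in TRUNCATED natural subtraction, which is vacuous for `r > n`.  Consumers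
(`NesterenkoZeroEnd`, the frames' exits A/B/C, `exists_matveev_step_data`) need `r ≤ n` explicitly
(lit g5, 2026-08-26T18:40Z remark (a)): it follows from the independence of the rows alone
(`rank_le_of_linearIndependent_int_rows`, over `ℚ` via `MatveevStepData.linearIndependent_ratCast_of_int`).
-/

namespace Summit.ABC.StewartYu.MatveevStepData

variable {n r : ℕ}

/-- **ℤ-independent integer rows are at most `n` in number**: `LinearIndependent ℤ M ⇒ r ≤ n` for
`M : Fin r → ℤⁿ`. [folklore] -/
theorem rank_le_of_linearIndependent_int_rows (M : Fin r → Fin n → ℤ) (hM : LinearIndependent ℤ M) :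
    r ≤ n := by
  have hQ := linearIndependent_ratCast_of_int M hM
  have h := hQ.fintype_card_le_finrank
  simpa using h

/-- The same with the fact's truncated dimension clause made honest: `H.addDim + (n − r) ≤ n` and
`LinearIndependent ℤ M` give `addDim + n ≤ n + r`, i.e. `addDim ≤ r` in `ℕ` without truncation.
[folklore] -/
theorem addDim_le_rank_of_dim_le {d₀ : ℕ} (M : Fin r → Fin n → ℤ) (hM : LinearIndependent ℤ M)
    (hdim : d₀ + (n - r) ≤ n) : d₀ ≤ r := by
  have hr := rank_le_of_linearIndependent_int_rows M hM
  omega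

end Summit.ABC.StewartYu.MatveevStepData
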